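import Literature.NumberTheory.EllipticCurves.IwasawaTwistedCocycleProofs
import Literature.NumberTheory.EllipticCurves.IwasawaAlgebraEisensteinTwistedInvariantsReadout
import HarnessLib

/-!
# `A_{m,k}`-twisted cocycles restrict to classes with `conj_γ w_j = w_j + w_{j-1}`: the tail class of a cocycle of
# `E[p^k] ⊗ A_{m,k}(ψ⁻¹)` restricted to `K_∞` lies in `ker((conj_γ − 1)^m + p)` (proofs only)

Topic `Literature/NumberTheory/EllipticCurves` (sequel to `IwasawaTwistedCocycleProofs` — the SCALAR twist `u ∈ ℤ` — and
`IwasawaAlgebraEisensteinTwistedInvariantsReadout`; cell `pub/bsd-print-x9`, the DISCRETE half of `stub_controlGlue` on the shared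
μ-crux, Howard Prop. 2.2.8 second map at `q_m = T^m + p`).  THEOREMS ONLY; no definition, no named fact, no instance, no `sorry`.

Let `κ` be a `ℤ_p`-extension of `K` with topological generator `γ` (`κ γ = 1`), `M` a discrete `Γ_K`-module killed by `p^k`
(`M = E[p^k]`), `A = A_{m,k} = Λ/(T^m + p, p^k)` and `χ : Γ_K → A` the values of a character TRIVIAL on `Gal(K̄/K_∞) = ker κ` with
`χ(γ) · (1 + T) = 1` — the INVERSE Eisenstein twist `ψ⁻¹`, `ψ(γ) = 1 + T` (the tree's `(κ.unitTwist (-1)).eisensteinTwist`,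
D1's `St`; x10b-p1 LEAD g7 17:27:04Z).  A **twisted crossed homomorphism** `f : Γ_K → A ⊗ M`,
`f(στ) = f(σ) + χ(σ) · (1 ⊗ σ) f(τ)` (the continuous 1-cocycles of `M ⊗ A(ψ⁻¹)`), has COORDINATES
`f_j := λ_k([π_j^*] · f) : Γ_K → M` (`tailReadout (dualFamily j • ·)` of the readout file), whose restrictions `φ_j` to `ker κ` are
honest cocycles.  THEOREM (`conjH1_oneCocycleClass_coord_eq`): in `H¹(K_∞, M)`

  `conj_γ [φ_j] = [φ_j] + [φ_{j−1}]`  (`1 ≤ j < m`),      `conj_γ [φ_0] = [φ_0] − p · [φ_{m−1}]`,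

because `(1 ⊗ γ) f(γ⁻¹hγ) = (1+T) · (f(h) + ((1⊗h) − 1) f(γ))` and `λ_k([π_j^*](1+T) x) = λ_k([π_j^*] x) + λ_k([π_{j}^*] T x)` with
`[T]` SHIFTING coordinates (`[T]^m = −p`).  Consequently (`psi_apply_oneCocycleClass_last_eq_zero`, pure algebra from the recursion)

  `((conj_γ − 1)^m + p) [φ_{m−1}] = 0`,   i.e. the TAIL class `[λ_k ∘ f |_{K_∞}]` lies in `ker ψ_m`,

`ψ_m = (conj_γ − 1)^m + p` being the endomorphism of `Sel_{p^∞}(E/K_∞)` Pontryagin-dual to `q_m = T^m + p` on `𝒳`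
(`SelmerDualData.toDual_qm_smul`, p643117); and the same after any equivariant change of coefficients `ι : M → N`
(`E[p^k] ↪ E[p^∞]`).  This is the FORWARD half of §1 of the discrete-control blueprint (HOME/p2/S1-DISCRETE-CONTROL-x10b-p2-g6.md):
the map `ι_{m,k} : H¹(K, A_q[p^k]) → H¹(K_∞, E[p^k])[ψ_m]` is well defined; its bijectivity (inflation–restriction, `E(K_∞)[p] = 0`)
and the local conditions are separate files.

References: [Howard2004HeegnerKolyvagin] B. Howard, Compositio Math. 140 (2004), Lemma 2.2.7, Prop. 2.2.8, proof of Thm. 2.2.10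
(«taking 𝔮 = T^m + p»); [GreenbergLNM1716] §4 p. 107 («H¹(F_∞, A_s) = H¹(F_∞, E[p^∞]) ⊗ κ^s»); [NeukirchSchmidtWingberg2008] I.§5
(conjugation on cochains); [Washington1997] §13.2.  BSD is not proved by any of this.
-/

noncomputable section

open CategoryTheory Literature.NumberTheory.EllipticCurves Literature.NumberTheory.GaloisRepresentations

universe u

namespace Literature.NumberTheory.EllipticCurves

namespace IwasawaDual

open IwasawaAlgebra

section EisensteinTwistedCocycle

variable {K : Type u} [Field K] {p : ℕ} [hp : Fact p.Prime] (κ : ZpExtension K p)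
variable {m : ℕ} (hm : 1 ≤ m) (k : ℕ)
variable {M : Type u} [AddCommGroup M] [DistribMulAction (Field.absoluteGaloisGroup K) M]
  [TopologicalSpace M] [DiscreteTopology M] (hM : ∀ x : M, (p ^ k) • x = 0)

/-! ### The coefficientwise action `1 ⊗ σ` on `A_{m,k} ⊗ M` and the coordinate readouts -/

omit [TopologicalSpace M] [DiscreteTopology M] in
/-- `(1 ⊗ θ₁θ₂) = (1 ⊗ θ₁)(1 ⊗ θ₂)` on `A ⊗ M`. [cite: NeukirchSchmidtWingberg2008, I.§5] -/
theorem mapEnd_mul_apply (θ₁ θ₂ : AddMonoid.End M) (x : EisensteinCoeff.Twisted p m k M) :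
    CoeffExtension.mapEnd (θ₁ * θ₂) x = CoeffExtension.mapEnd θ₁ (CoeffExtension.mapEnd θ₂ x) := by
  induction x using EisensteinCoeff.Twisted.induction_on with
  | zero => rw [map_zero, map_zero, map_zero]
  | tmul c a => rw [CoeffExtension.mapEnd_tmul, CoeffExtension.mapEnd_tmul, CoeffExtension.mapEnd_tmul]; rfl
  | add x y hx hy => rw [map_add, map_add, map_add, hx, hy]

omit [TopologicalSpace M] [DiscreteTopology M] in
/-- `(1 ⊗ 1) = id` on `A ⊗ M`. [cite: NeukirchSchmidtWingberg2008, I.§5] -/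
theorem mapEnd_one_apply (x : EisensteinCoeff.Twisted p m k M) :
    CoeffExtension.mapEnd (1 : AddMonoid.End M) x = x := by
  induction x using EisensteinCoeff.Twisted.induction_on with
  | zero => rw [map_zero]
  | tmul c a => rw [CoeffExtension.mapEnd_tmul]; rfl
  | add x y hx hy => rw [map_add, hx, hy]

omit [TopologicalSpace M] [DiscreteTopology M] in
/-- `(1 ⊗ στ) = (1 ⊗ σ)(1 ⊗ τ)` for the Galois action `σ ↦ 1 ⊗ σ` (`DistribMulAction.toAddMonoidEnd`).
[cite: NeukirchSchmidtWingberg2008, I.§5] -/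
theorem mapEnd_toAddMonoidEnd_mul (σ τ : Field.absoluteGaloisGroup K) (x : EisensteinCoeff.Twisted p m k M) :
    CoeffExtension.mapEnd (DistribMulAction.toAddMonoidEnd _ M (σ * τ)) x =
      CoeffExtension.mapEnd (DistribMulAction.toAddMonoidEnd _ M σ)
        (CoeffExtension.mapEnd (DistribMulAction.toAddMonoidEnd _ M τ) x) := by
  rw [map_mul, mapEnd_mul_apply]

omit [TopologicalSpace M] [DiscreteTopology M] in
/-- `(1 ⊗ 1) = id` for the Galois action. [cite: NeukirchSchmidtWingberg2008, I.§5] -/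
theorem mapEnd_toAddMonoidEnd_one (x : EisensteinCoeff.Twisted p m k M) :
    CoeffExtension.mapEnd (DistribMulAction.toAddMonoidEnd _ M (1 : Field.absoluteGaloisGroup K)) x = x := by
  rw [map_one, mapEnd_one_apply]

omit [TopologicalSpace M] [DiscreteTopology M] in
/-- **The coordinate readouts are `Γ_K`-equivariant**: `λ_k([π_j^*] · (1 ⊗ σ) x) = σ · λ_k([π_j^*] · x)`.
[cite: GreenbergLNM1716, §4 p. 107] -/
theorem tailReadout_dualFamily_smul_mapEnd (σ : Field.absoluteGaloisGroup K) (j : Fin m)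
    (x : EisensteinCoeff.Twisted p m k M) :
    EisensteinCoeff.Twisted.tailReadout p hm k hM (EisensteinCoeff.dualFamily p hm k j •
      CoeffExtension.mapEnd (DistribMulAction.toAddMonoidEnd _ M σ) x) =
      σ • EisensteinCoeff.Twisted.tailReadout p hm k hM (EisensteinCoeff.dualFamily p hm k j • x) :=
  CoeffExtension.readout_smul_mapEnd _ hM _ _ x

omit [TopologicalSpace M] [DiscreteTopology M] in
/-- **`[T]` shifts the coordinates**: `λ_k([π_j^*][T] x) = λ_k([π_{j-1}^*] x)` for `j ≥ 1` and `= −p · λ_k([π_{m-1}^*] x)` for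
`j = 0` (`[T]^m = −p`). [cite: Howard2004HeegnerKolyvagin, proof of Thm. 2.2.10 (𝔮 = T^m + p)] [cite: Washington1997, §13.2] -/
theorem tailReadout_dualFamily_smul_X_smul (j : Fin m) (x : EisensteinCoeff.Twisted p m k M) :
    EisensteinCoeff.Twisted.tailReadout p hm k hM (EisensteinCoeff.dualFamily p hm k j •
      (Ideal.Quotient.mk _ (PowerSeries.X : IwasawaAlgebra p) : EisensteinCoeff p m k) • x) =
      if (j : ℕ) = 0 then
        -(p • EisensteinCoeff.Twisted.tailReadout p hm k hM (EisensteinCoeff.dualFamily p hm k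
          ⟨m - 1, Nat.sub_lt (lt_of_lt_of_le zero_lt_one hm) zero_lt_one⟩ • x))
      else EisensteinCoeff.Twisted.tailReadout p hm k hM (EisensteinCoeff.dualFamily p hm k
          ⟨(j : ℕ) - 1, lt_of_le_of_lt (Nat.sub_le _ _) j.2⟩ • x) := by
  conv_lhs => rw [EisensteinCoeff.Twisted.eq_sum_tmul_tailReadout p hm k hM x]
  exact EisensteinCoeff.Twisted.tailReadout_dualFamily_smul_X_smul_sum p hm k hM _ j

omit [TopologicalSpace M] [DiscreteTopology M] in
/-- **`1 + T` on coordinates**: `λ_k([π_j^*](1+T) x) = λ_k([π_j^*] x) + λ_k([π_j^*][T] x)`.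
[cite: Howard2004HeegnerKolyvagin, proof of Thm. 2.2.10 (𝔮 = T^m + p)] -/
theorem tailReadout_dualFamily_smul_onePlusT_smul (j : Fin m) (x : EisensteinCoeff.Twisted p m k M) :
    EisensteinCoeff.Twisted.tailReadout p hm k hM (EisensteinCoeff.dualFamily p hm k j •
      EisensteinCoeff.onePlusT p m k • x) =
      EisensteinCoeff.Twisted.tailReadout p hm k hM (EisensteinCoeff.dualFamily p hm k j • x) +
        EisensteinCoeff.Twisted.tailReadout p hm k hM (EisensteinCoeff.dualFamily p hm k j •
          (Ideal.Quotient.mk _ (PowerSeries.X : IwasawaAlgebra p) : EisensteinCoeff p m k) • x) := by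
  rw [EisensteinCoeff.onePlusT_def, map_add, map_one, add_smul, one_smul, smul_add, map_add]

/-! ### The main identity -/

/-- **`A_{m,k}`-twisted cocycles restrict to classes with the SHIFT relation.**  Let `κ` be a `ℤ_p`-extension of `K` with
topological generator `γ`, `M` a discrete `Γ_K`-module killed by `p^k`, `χ : Γ_K → A_{m,k}` multiplicative, trivial on `ker κ`,
with `χ(γ)(1+T) = 1` (the inverse Eisenstein twist), and `f : Γ_K → A_{m,k} ⊗ M` a twisted crossed homomorphism,
`f(στ) = f(σ) + χ(σ) · (1 ⊗ σ) f(τ)`.  If for every `j < m` the continuous cocycle `φ_j` on `ker κ` agrees with the coordinate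
`λ_k([π_j^*] · f)`, then in `H¹(K_∞, M)`:
`conj_γ [φ_j] = [φ_j] + [φ_{j−1}]` for `j ≥ 1` and `conj_γ [φ_0] = [φ_0] − p · [φ_{m−1}]`.
Proof: `(conj_γ φ_j)(h) = γ·f_j(γ⁻¹hγ) = λ_k([π_j^*] (1⊗γ) f(γ⁻¹hγ))` and `(1⊗γ) f(γ⁻¹hγ) = (1+T)(f(h) + ((1⊗h) − 1) f(γ))`
(`χ(γ⁻¹) = 1 + T`, `(1⊗γ) f(γ⁻¹) = −(1+T) f(γ)`); read `(1+T) = 1 + [T]` with the shift lemma; the `f(γ)`-terms are the coboundary of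
`λ_k([π_j^*](1+T) f(γ))`. [cite: GreenbergLNM1716, §4 p. 107] [cite: Howard2004HeegnerKolyvagin, Lemma 2.2.7 / Prop. 2.2.8 and proof of Thm. 2.2.10 (𝔮 = T^m + p)]
[cite: NeukirchSchmidtWingberg2008, I.§5] -/
theorem conjH1_oneCocycleClass_coord_eq {γ : Field.absoluteGaloisGroup K}
    (χ : Field.absoluteGaloisGroup K → EisensteinCoeff p m k)
    (hχmul : ∀ σ τ, χ (σ * τ) = χ σ * χ τ) (hχker : ∀ σ ∈ κ.kerSubgroup, χ σ = 1)
    (hχγ : χ γ * EisensteinCoeff.onePlusT p m k = 1)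
    (f : Field.absoluteGaloisGroup K → EisensteinCoeff.Twisted p m k M)
    (hf : ∀ σ τ : Field.absoluteGaloisGroup K,
      f (σ * τ) = f σ + χ σ • CoeffExtension.mapEnd (DistribMulAction.toAddMonoidEnd _ M σ) (f τ))
    (φ : Fin m → contOneCocycles (discreteTopRep κ.kerSubgroup M))
    (hφ : ∀ (j : Fin m) (h : κ.kerSubgroup), (φ j).1 h =
      EisensteinCoeff.Twisted.tailReadout p hm k hM (EisensteinCoeff.dualFamily p hm k j • f h))
    (j : Fin m) :
    conjH1 κ.kerSubgroup M γ (oneCocycleClass _ (φ j)) =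
      oneCocycleClass _ (φ j) +
        (if (j : ℕ) = 0 then
          -(p • oneCocycleClass _ (φ ⟨m - 1, Nat.sub_lt (lt_of_lt_of_le zero_lt_one hm) zero_lt_one⟩))
        else oneCocycleClass _ (φ ⟨(j : ℕ) - 1, lt_of_le_of_lt (Nat.sub_le _ _) j.2⟩)) := by
  -- `χ 1 = 1`, `f 1 = 0`
  have hχ1 : χ 1 = 1 := hχker 1 (one_mem _)
  have hf1 : f 1 = 0 := by
    have h := hf 1 1
    rw [mul_one, hχ1, one_smul, mapEnd_toAddMonoidEnd_one] at h
    simpa using h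
  -- `χ γ⁻¹ = 1 + T`
  have hχinv : χ γ⁻¹ = EisensteinCoeff.onePlusT p m k := by
    have h1 : χ γ * χ γ⁻¹ = 1 := by rw [← hχmul, mul_inv_cancel, hχ1]
    calc χ γ⁻¹ = (χ γ * EisensteinCoeff.onePlusT p m k) * χ γ⁻¹ := by rw [hχγ, one_mul]
      _ = EisensteinCoeff.onePlusT p m k * (χ γ * χ γ⁻¹) := by ring
      _ = EisensteinCoeff.onePlusT p m k := by rw [h1, mul_one]
  -- `(1 ⊗ γ) f(γ⁻¹) = -(1+T) • f γ`
  have hγinv : CoeffExtension.mapEnd (DistribMulAction.toAddMonoidEnd _ M γ) (f γ⁻¹) =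
      -(EisensteinCoeff.onePlusT p m k • f γ) := by
    have h := hf γ γ⁻¹
    rw [mul_inv_cancel, hf1] at h
    -- `0 = f γ + χ γ • (1⊗γ) f γ⁻¹`; multiply by `1 + T`
    have h2 : EisensteinCoeff.onePlusT p m k • (f γ + χ γ •
        CoeffExtension.mapEnd (DistribMulAction.toAddMonoidEnd _ M γ) (f γ⁻¹)) = 0 := by
      rw [← h, smul_zero]
    rw [smul_add, smul_smul, mul_comm, hχγ, one_smul, add_comm, add_eq_zero_iff_eq_neg] at h2
    exact h2
  -- conjugation on the explicit cocycle (as in the scalar file)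
  have hc : ∀ (x : κ.kerSubgroup) (a : M), DistribSMul.toAddMonoidHom M γ (subgroupConj κ.kerSubgroup γ x • a) =
      x • DistribSMul.toAddMonoidHom M γ a := fun x a ↦ by
    simp only [DistribSMul.toAddMonoidHom_apply, Subgroup.smul_def, subgroupConj_apply_coe,
      smul_smul, mul_assoc, mul_inv_cancel_left]
  set ψ := contOneCocycles.pullback (subgroupConj κ.kerSubgroup γ)
    (resHomOfEquivariant (subgroupConj κ.kerSubgroup γ) (DistribSMul.toAddMonoidHom M γ) hc) (φ j) with hψ
  have key : conjH1 κ.kerSubgroup M γ (oneCocycleClass _ (φ j)) = oneCocycleClass _ ψ :=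
    map_oneCocycleClass (discreteTopRep κ.kerSubgroup M) (subgroupConj κ.kerSubgroup γ)
      (resHomOfEquivariant (subgroupConj κ.kerSubgroup γ) (DistribSMul.toAddMonoidHom M γ) hc) (φ j)
  have hψapply : ∀ h : κ.kerSubgroup, ψ.1 h =
      γ • EisensteinCoeff.Twisted.tailReadout p hm k hM (EisensteinCoeff.dualFamily p hm k j • f (γ⁻¹ * h * γ)) := fun h ↦ by
    rw [hψ, contOneCocycles.pullback_apply]
    change γ • (φ j).1 (subgroupConj κ.kerSubgroup γ h) = _
    rw [hφ, subgroupConj_apply_coe]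
  -- the twisted cocycle identity: `(1⊗γ) f(γ⁻¹ h γ) = (1+T) • (f h + ((1⊗h) − 1) f γ)` for `h ∈ ker κ`
  have hexp : ∀ h : κ.kerSubgroup, CoeffExtension.mapEnd (DistribMulAction.toAddMonoidEnd _ M γ) (f (γ⁻¹ * h * γ)) =
      EisensteinCoeff.onePlusT p m k • (f h +
        (CoeffExtension.mapEnd (DistribMulAction.toAddMonoidEnd _ M (h : Field.absoluteGaloisGroup K)) (f γ) - f γ)) :=
    fun h ↦ by
    have hh : χ (h : Field.absoluteGaloisGroup K) = 1 := hχker _ h.2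
    have h1 : f (γ⁻¹ * h * γ) = f γ⁻¹ + χ γ⁻¹ • CoeffExtension.mapEnd (DistribMulAction.toAddMonoidEnd _ M γ⁻¹)
        (f h + CoeffExtension.mapEnd (DistribMulAction.toAddMonoidEnd _ M (h : Field.absoluteGaloisGroup K)) (f γ)) := by
      rw [mul_assoc, hf γ⁻¹, hf (h : Field.absoluteGaloisGroup K) γ, hh, one_smul]
    rw [h1, map_add, map_smul, ← mapEnd_toAddMonoidEnd_mul, mul_inv_cancel, mapEnd_toAddMonoidEnd_one, hγinv, hχinv,
      smul_add, smul_add, smul_sub]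
    abel
  -- readouts of `f γ` (the coboundary element) and of `f h`
  set Rγ : Fin m → M := fun i ↦ EisensteinCoeff.Twisted.tailReadout p hm k hM (EisensteinCoeff.dualFamily p hm k i • f γ)
    with hRγ
  -- evaluation of `ψ` at `h`: `ψ h = R_j y + R_j (T • y)`, `y = f h + ((1⊗h) − 1) f γ`, everything read in coordinates
  have hψval : ∀ h : κ.kerSubgroup, ψ.1 h =
      (EisensteinCoeff.Twisted.tailReadout p hm k hM (EisensteinCoeff.dualFamily p hm k j • f h) +
          ((h : Field.absoluteGaloisGroup K) • Rγ j - Rγ j)) +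
        (if (j : ℕ) = 0 then
          -(p • (EisensteinCoeff.Twisted.tailReadout p hm k hM (EisensteinCoeff.dualFamily p hm k
              ⟨m - 1, Nat.sub_lt (lt_of_lt_of_le zero_lt_one hm) zero_lt_one⟩ • f h) +
            ((h : Field.absoluteGaloisGroup K) • Rγ ⟨m - 1, Nat.sub_lt (lt_of_lt_of_le zero_lt_one hm) zero_lt_one⟩ -
              Rγ ⟨m - 1, Nat.sub_lt (lt_of_lt_of_le zero_lt_one hm) zero_lt_one⟩)))
        else
          EisensteinCoeff.Twisted.tailReadout p hm k hM (EisensteinCoeff.dualFamily p hm k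
              ⟨(j : ℕ) - 1, lt_of_le_of_lt (Nat.sub_le _ _) j.2⟩ • f h) +
            ((h : Field.absoluteGaloisGroup K) • Rγ ⟨(j : ℕ) - 1, lt_of_le_of_lt (Nat.sub_le _ _) j.2⟩ -
              Rγ ⟨(j : ℕ) - 1, lt_of_le_of_lt (Nat.sub_le _ _) j.2⟩)) := fun h ↦ by
    have hread : ∀ i : Fin m, EisensteinCoeff.Twisted.tailReadout p hm k hM (EisensteinCoeff.dualFamily p hm k i •
        (f h + (CoeffExtension.mapEnd (DistribMulAction.toAddMonoidEnd _ M (h : Field.absoluteGaloisGroup K)) (f γ) - f γ))) =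
        EisensteinCoeff.Twisted.tailReadout p hm k hM (EisensteinCoeff.dualFamily p hm k i • f h) +
          ((h : Field.absoluteGaloisGroup K) • Rγ i - Rγ i) := fun i ↦ by
      rw [smul_add, smul_sub, map_add, map_sub, tailReadout_dualFamily_smul_mapEnd]
    rw [hψapply, ← tailReadout_dualFamily_smul_mapEnd (hm := hm) (hM := hM), hexp,
      tailReadout_dualFamily_smul_onePlusT_smul, tailReadout_dualFamily_smul_X_smul, hread]
    by_cases hj : (j : ℕ) = 0
    · rw [if_pos hj, if_pos hj, hread]
    · rw [if_neg hj, if_neg hj, hread]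
  rw [key]
  by_cases hj : (j : ℕ) = 0
  · have hns : oneCocycleClass (discreteTopRep κ.kerSubgroup M)
        (p • φ ⟨m - 1, Nat.sub_lt (lt_of_lt_of_le zero_lt_one hm) zero_lt_one⟩) =
        p • oneCocycleClass _ (φ ⟨m - 1, Nat.sub_lt (lt_of_lt_of_le zero_lt_one hm) zero_lt_one⟩) :=
      map_nsmul (oneCocycleClassₗ (discreteTopRep κ.kerSubgroup M)) p _
    rw [if_pos hj, ← sub_eq_zero, ← sub_sub, sub_neg_eq_add, ← oneCocycleClass_sub, ← hns, ← oneCocycleClass_add,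
      oneCocycleClass_eq_zero_iff]
    refine ⟨Rγ j - p • Rγ ⟨m - 1, Nat.sub_lt (lt_of_lt_of_le zero_lt_one hm) zero_lt_one⟩, fun h ↦ ?_⟩
    change ψ.1 h - (φ j).1 h + p • (φ ⟨m - 1, _⟩).1 h =
      (h : Field.absoluteGaloisGroup K) • (Rγ j - p • Rγ ⟨m - 1, _⟩) - (Rγ j - p • Rγ ⟨m - 1, _⟩)
    rw [hψval, if_pos hj, hφ, hφ, smul_sub, smul_comm (h : Field.absoluteGaloisGroup K) p, nsmul_add, nsmul_sub]
    abel
  · rw [if_neg hj, ← sub_eq_zero, ← sub_sub, ← oneCocycleClass_sub, ← oneCocycleClass_sub, oneCocycleClass_eq_zero_iff]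
    refine ⟨Rγ j + Rγ ⟨(j : ℕ) - 1, lt_of_le_of_lt (Nat.sub_le _ _) j.2⟩, fun h ↦ ?_⟩
    change ψ.1 h - (φ j).1 h - (φ ⟨(j : ℕ) - 1, _⟩).1 h =
      (h : Field.absoluteGaloisGroup K) • (Rγ j + Rγ ⟨(j : ℕ) - 1, _⟩) - (Rγ j + Rγ ⟨(j : ℕ) - 1, _⟩)
    rw [hψval, if_neg hj, hφ, hφ, smul_add]
    abel

/-! ### The recursion kills the tail class by `ψ_m = (conj_γ − 1)^m + p` -/

omit [DistribMulAction (Field.absoluteGaloisGroup K) M] [TopologicalSpace M] [DiscreteTopology M] hp in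
/-- **Pure algebra**: if `θ c_j = c_j + c_{j−1}` (`1 ≤ j < m`) and `θ c_0 = c_0 − p c_{m−1}` in an abelian group, then
`c_{m−1−d} = (θ − 1)^d c_{m−1}` for `d < m`. [cite: Howard2004HeegnerKolyvagin, proof of Thm. 2.2.10 (𝔮 = T^m + p)] -/
theorem coord_eq_pow_sub_one_apply_last {H : Type u} [AddCommGroup H] (θ : AddMonoid.End H) (c : Fin m → H)
    (hrec : ∀ j : Fin m, θ (c j) = c j + (if (j : ℕ) = 0 then
      -(p • c ⟨m - 1, Nat.sub_lt (lt_of_lt_of_le zero_lt_one hm) zero_lt_one⟩)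
      else c ⟨(j : ℕ) - 1, lt_of_le_of_lt (Nat.sub_le _ _) j.2⟩))
    {d : ℕ} (hd : d < m) :
    c ⟨m - 1 - d, lt_of_le_of_lt (Nat.sub_le _ _) (Nat.sub_lt (lt_of_lt_of_le zero_lt_one hm) zero_lt_one)⟩ =
      ((θ - 1) ^ d) (c ⟨m - 1, Nat.sub_lt (lt_of_lt_of_le zero_lt_one hm) zero_lt_one⟩) := by
  induction d with
  | zero => simp only [Nat.sub_zero, pow_zero, AddMonoid.End.one_apply]
  | succ d ih =>
    have hd' : d < m := Nat.lt_of_succ_lt hd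
    have hstep : ∀ i : Fin m, ((θ - 1) (c i)) = (if (i : ℕ) = 0 then
        -(p • c ⟨m - 1, Nat.sub_lt (lt_of_lt_of_le zero_lt_one hm) zero_lt_one⟩)
        else c ⟨(i : ℕ) - 1, lt_of_le_of_lt (Nat.sub_le _ _) i.2⟩) := fun i ↦ by
      show θ (c i) - (1 : AddMonoid.End H) (c i) = _
      rw [AddMonoid.End.one_apply, hrec i, add_sub_cancel_left]
    rw [pow_succ', show ∀ x, ((θ - 1) * (θ - 1) ^ d) x = (θ - 1) (((θ - 1) ^ d) x) from fun _ ↦ rfl, ← ih hd', hstep]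
    have hne : ¬ (((⟨m - 1 - d, lt_of_le_of_lt (Nat.sub_le _ _)
        (Nat.sub_lt (lt_of_lt_of_le zero_lt_one hm) zero_lt_one)⟩ : Fin m) : ℕ) = 0) := by
      show ¬ (m - 1 - d = 0); omega
    rw [if_neg hne]
    exact congrArg c (Fin.ext (by show m - 1 - (d + 1) = m - 1 - d - 1; omega))

omit [DistribMulAction (Field.absoluteGaloisGroup K) M] [TopologicalSpace M] [DiscreteTopology M] hp in
/-- **Pure algebra**: under the same recursion, `((θ − 1)^m + p) c_{m−1} = 0`.
[cite: Howard2004HeegnerKolyvagin, proof of Thm. 2.2.10 (𝔮 = T^m + p)] [cite: GreenbergLNM1716, §4 p. 98] -/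
theorem psi_apply_last_eq_zero_of_rec {H : Type u} [AddCommGroup H] (θ : AddMonoid.End H) (c : Fin m → H)
    (hrec : ∀ j : Fin m, θ (c j) = c j + (if (j : ℕ) = 0 then
      -(p • c ⟨m - 1, Nat.sub_lt (lt_of_lt_of_le zero_lt_one hm) zero_lt_one⟩)
      else c ⟨(j : ℕ) - 1, lt_of_le_of_lt (Nat.sub_le _ _) j.2⟩)) :
    ((θ - 1) ^ m + (p : AddMonoid.End H)) (c ⟨m - 1, Nat.sub_lt (lt_of_lt_of_le zero_lt_one hm) zero_lt_one⟩) = 0 := by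
  have h0 := coord_eq_pow_sub_one_apply_last (p := p) hm θ c hrec (d := m - 1)
    (Nat.sub_lt (lt_of_lt_of_le zero_lt_one hm) zero_lt_one)
  have hidx : (⟨m - 1 - (m - 1), lt_of_le_of_lt (Nat.sub_le _ _)
      (Nat.sub_lt (lt_of_lt_of_le zero_lt_one hm) zero_lt_one)⟩ : Fin m) = ⟨0, lt_of_lt_of_le zero_lt_one hm⟩ :=
    Fin.ext (by show m - 1 - (m - 1) = 0; omega)
  rw [hidx] at h0
  have hrec0 : (θ - 1) (c ⟨0, lt_of_lt_of_le zero_lt_one hm⟩) =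
      -(p • c ⟨m - 1, Nat.sub_lt (lt_of_lt_of_le zero_lt_one hm) zero_lt_one⟩) := by
    show θ (c _) - (1 : AddMonoid.End H) (c _) = _
    rw [AddMonoid.End.one_apply, hrec, if_pos rfl, add_sub_cancel_left]
  have hpow : (θ - 1) ^ m = (θ - 1) * (θ - 1) ^ (m - 1) := by
    rw [← pow_succ', Nat.sub_add_cancel hm]
  show ((θ - 1) ^ m) (c _) + (p : AddMonoid.End H) (c _) = 0
  rw [AddMonoid.End.natCast_apply, hpow, show ∀ x, ((θ - 1) * (θ - 1) ^ (m - 1)) x = (θ - 1) (((θ - 1) ^ (m - 1)) x)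
    from fun _ ↦ rfl, ← h0, hrec0, neg_add_cancel]

/-- **The tail class of a twisted cocycle lies in `ker ψ_m`**: with the data of `conjH1_oneCocycleClass_coord_eq`,
`((conj_γ − 1)^m + p) [φ_{m−1}] = 0` in `H¹(K_∞, M)` — the class `ι_{m,k}(f) := [λ_k ∘ f|_{K_∞}]` is killed by
`ψ_m = (conj_γ − 1)^m + p` (stated for any `θ : AddMonoid.End H¹(K_∞, M)` agreeing with `conj_γ`, e.g. the tree's
`conjSelmerInfty`-style endomorphisms). [cite: Howard2004HeegnerKolyvagin, Lemma 2.2.7 / Prop. 2.2.8 and proof of Thm. 2.2.10 (𝔮 = T^m + p)]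
[cite: GreenbergLNM1716, §4 pp. 98, 107] -/
theorem psi_apply_oneCocycleClass_last_eq_zero {γ : Field.absoluteGaloisGroup K}
    (χ : Field.absoluteGaloisGroup K → EisensteinCoeff p m k)
    (hχmul : ∀ σ τ, χ (σ * τ) = χ σ * χ τ) (hχker : ∀ σ ∈ κ.kerSubgroup, χ σ = 1)
    (hχγ : χ γ * EisensteinCoeff.onePlusT p m k = 1)
    (f : Field.absoluteGaloisGroup K → EisensteinCoeff.Twisted p m k M)
    (hf : ∀ σ τ : Field.absoluteGaloisGroup K,
      f (σ * τ) = f σ + χ σ • CoeffExtension.mapEnd (DistribMulAction.toAddMonoidEnd _ M σ) (f τ))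
    (φ : Fin m → contOneCocycles (discreteTopRep κ.kerSubgroup M))
    (hφ : ∀ (j : Fin m) (h : κ.kerSubgroup), (φ j).1 h =
      EisensteinCoeff.Twisted.tailReadout p hm k hM (EisensteinCoeff.dualFamily p hm k j • f h))
    (θ : AddMonoid.End (subgroupH1 κ.kerSubgroup M)) (hθ : ∀ c, θ c = conjH1 κ.kerSubgroup M γ c) :
    ((θ - 1) ^ m + (p : AddMonoid.End (subgroupH1 κ.kerSubgroup M)))
      (oneCocycleClass _ (φ ⟨m - 1, Nat.sub_lt (lt_of_lt_of_le zero_lt_one hm) zero_lt_one⟩)) = 0 :=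
  psi_apply_last_eq_zero_of_rec (p := p) hm θ (fun j ↦ oneCocycleClass _ (φ j))
    (fun j ↦ (hθ _).trans (conjH1_oneCocycleClass_coord_eq κ hm k hM χ hχmul hχker hχγ f hf φ hφ j))

variable {N : Type u} [AddCommGroup N] [DistribMulAction (Field.absoluteGaloisGroup K) N]
  [TopologicalSpace N] [DiscreteTopology N]

/-- **Change of coefficients** (`E[p^k] ↪ E[p^∞]`): for an equivariant additive `ι : M → N` the pushed tail class
`ι_* [φ_{m−1}] ∈ H¹(K_∞, N)` is killed by `(conj_γ − 1)^m + p` as well (conjugation commutes with `ι_*`,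
`conjH1_comp_resH1Hom_id`). [cite: GreenbergLNM1716, §4 pp. 107, 124] [cite: Howard2004HeegnerKolyvagin, Prop. 2.2.8] -/
theorem psi_apply_resH1Hom_oneCocycleClass_last_eq_zero {γ : Field.absoluteGaloisGroup K}
    (χ : Field.absoluteGaloisGroup K → EisensteinCoeff p m k)
    (hχmul : ∀ σ τ, χ (σ * τ) = χ σ * χ τ) (hχker : ∀ σ ∈ κ.kerSubgroup, χ σ = 1)
    (hχγ : χ γ * EisensteinCoeff.onePlusT p m k = 1)
    (f : Field.absoluteGaloisGroup K → EisensteinCoeff.Twisted p m k M)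
    (hf : ∀ σ τ : Field.absoluteGaloisGroup K,
      f (σ * τ) = f σ + χ σ • CoeffExtension.mapEnd (DistribMulAction.toAddMonoidEnd _ M σ) (f τ))
    (φ : Fin m → contOneCocycles (discreteTopRep κ.kerSubgroup M))
    (hφ : ∀ (j : Fin m) (h : κ.kerSubgroup), (φ j).1 h =
      EisensteinCoeff.Twisted.tailReadout p hm k hM (EisensteinCoeff.dualFamily p hm k j • f h))
    (ι : M →+ N) (hι : ∀ (g : Field.absoluteGaloisGroup K) (a : M), ι (g • a) = g • ι a)
    (hι' : ∀ (x : κ.kerSubgroup) (a : M), ι (ContinuousMonoidHom.id κ.kerSubgroup x • a) = x • ι a)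
    (θ : AddMonoid.End (subgroupH1 κ.kerSubgroup N)) (hθ : ∀ c, θ c = conjH1 κ.kerSubgroup N γ c) :
    ((θ - 1) ^ m + (p : AddMonoid.End (subgroupH1 κ.kerSubgroup N)))
      (resH1Hom (ContinuousMonoidHom.id κ.kerSubgroup) ι hι'
        (oneCocycleClass _ (φ ⟨m - 1, Nat.sub_lt (lt_of_lt_of_le zero_lt_one hm) zero_lt_one⟩))) = 0 := by
  refine psi_apply_last_eq_zero_of_rec (p := p) hm θ
    (fun j ↦ resH1Hom (ContinuousMonoidHom.id κ.kerSubgroup) ι hι' (oneCocycleClass _ (φ j))) fun j ↦ ?_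
  rw [hθ, ← AddMonoidHom.comp_apply, conjH1_comp_resH1Hom_id κ ι hι hι', AddMonoidHom.comp_apply,
    conjH1_oneCocycleClass_coord_eq κ hm k hM χ hχmul hχker hχγ f hf φ hφ j, map_add]
  by_cases hj : (j : ℕ) = 0
  · rw [if_pos hj, if_pos hj, map_neg, map_nsmul]
  · rw [if_neg hj, if_neg hj]

end EisensteinTwistedCocycle

end IwasawaDual

end Literature.NumberTheory.EllipticCurves
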